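import Literature.AlgebraicGeometry.Frobenioids.BiratLocalizationUniversal
import Literature.AlgebraicGeometry.Frobenioids.BirationalizationFunctor
import Literature.AlgebraicGeometry.Frobenioids.BiratGerms
import Literature.AlgebraicGeometry.Frobenioids.DivisorMonoidCategoryTheoreticityDefs
import Literature.AlgebraicGeometry.Frobenioids.PreFrobenioidDataOfFunctor
import HarnessLib

/-!
# Frobenioids I, Proposition 4.8 (i): the birationalization of a Frobenioid of isotropic type is of
# isotropic type — PROVED for THE birationalization

Mochizuki, *The geometry of Frobenioids I: the general theory*, Kyushu J. Math. **62** (2008)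
293–400, §4, Proposition 4.8 (i), kurims text p. 88 [cite: MochizukiFrdI2008, Prop. 4.8 (i) p.88]:
"(i) If `C` is of isotropic type, then so is `C^birat`", with the printed proof "Assertion (i) follows
formally from Proposition 4.4, (iv)" — namely from the portion of the dictionary of Prop. 4.4 (iv)
(p. 83) "co-angular pre-step [of `C`] ↦ isomorphism [of `C^birat`]" and "pre-step ↦ pre-step", together
with Prop. 1.4 (i) (in a Frobenioid of isotropic type every pre-step is co-angular).

PROOF-ONLY companion (theorems only, no new definitions) of seat abc-iut-L1-t3's statement file
`DivisorMonoidCategoryTheoreticityDefs.lean`, whose `PreFrobenioidData.Prop48i S B` types Prop. 4.8 (i)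
over a birationalization datum `B : S.BiratData` (an INTERFACE; "statements over a `BiratData` are
faithful when it is instantiated with THE birationalization … never quantify universally over it").
Here the statement is proved for THE birationalization of a Frobenioid `F : C ⥤ F_Φ` constructed in
the tree (seat abc-iut-L6-t8: `PreFrobenioid.Birat F hF hsq`, `toBirat F hF hsq`,
`Birat.toElemZero hF hsq : C^birat ⥤ F_{0_D}` — the pre-Frobenioid structure "determined by the functor
`C^birat → F_{0_D}`" of Prop. 4.4 (ii); seat abc-iut-L6-t6: `toBirat_inverts`,
`Birat.homMk_eq_inv_comp`):

* `PreFrobenioid.Birat.isPreStep_num` — a pre-step `[(α, φ′)]` of `C^birat` has `φ′` a pre-step of `C`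
  (Prop. 4.4 (iv) "pre-step ↦ pre-step", the direction used here);
* `PreFrobenioid.Birat.isIso_of_isPreStep` — if `C` is of isotropic type, every pre-step of `C^birat`
  is an isomorphism (`[(α, φ′)] = α⁻¹ ∘ φ′` with `α`, `φ′` co-angular pre-steps, both inverted by
  `C → C^birat`);
* `PreFrobenioid.Birat.isOfIsotropicType` — **Prop. 4.8 (i)** for `C^birat ⥤ F_{0_D}` (every morphism
  of `C^birat` is an isometry, `0_D` being the zero monoid, so "isotropic" = "every pre-step out of the
  object is an isomorphism");
* `PreFrobenioidData.isOfIsotropicType_ofFunctor_toElemZero` — the same through the §3–§4 statement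
  interface: `(ofFunctor Φ F).IsOfIsotropicType → (ofFunctor 0_D (Birat.toElemZero hF hsq)).IsOfIsotropicType`,
  i.e. literally the body of `Prop48i` at the operations `ofFunctor 0_D (Birat.toElemZero hF hsq)` of
  THE birationalization (the `ops` field of abc-iut-L6-t6's staged `biratData hF hsq`; the one-line
  corollary `Prop48i (biratData hF hsq)` is filed as an append once that definition lands).

The square-completion hypothesis `hsq : HasBiratSquares F` of the construction is Prop. 1.11 (vii)
(discharged for every Frobenioid in `BiratLocalization.lean`, seat abc-iut-L6-t6). Node
`FrdI:Prop4.8(i)` (abc-iut cell, seat abc-iut-L6-t20). No statement of the paper is strengthened;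
nothing here concerns the disputed parts of IUT.
-/

namespace Literature.AlgebraicGeometry.Frobenioids

open CategoryTheory Opposite

universe w v v' u u'

namespace PreFrobenioid

variable {D : Type u} [Category.{v} D] {Φ : Dᵒᵖ ⥤ CommMonCat.{w}}
  {C : Type u'} [Category.{v'} C] {F : C ⥤ ElemFrobenioid Φ}
  {hF : IsFrobenioid F} {hsq : HasBiratSquares F}

namespace Birat

/-! ### The operations of `C^birat → F_{0_D}` on classes of fractions -/

/-- `deg_Fr` of `C^birat → F_{0_D}` on the class `[(α, φ′)]` is `deg_Fr(φ′)` (Prop. 4.4 (iv): "morphism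
of a given Frobenius degree ↦ morphism of [that] Frobenius degree").
[cite: MochizukiFrdI2008, Prop. 4.4 (iv) p.83] -/
theorem degFr_toElemZero_homMk {X Y : Birat F hF hsq} (f : BiratFrac F X.out Y.out) :
    degFr (toElemZero hF hsq) (homMk f) = BiratFrac.deg f := rfl

/-- `Base` of `C^birat → F_{0_D}` on the class `[(α, φ′)]` is `Base(α)⁻¹ ≫ Base(φ′)`.
[cite: MochizukiFrdI2008, Prop. 4.4 (i) p.84] -/
theorem base_toElemZero_homMk {X Y : Birat F hF hsq} (f : BiratFrac F X.out Y.out) :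
    Base (toElemZero hF hsq) (homMk f) = BiratFrac.base f := rfl

/-- Every morphism of `C^birat` is an isometry for `C^birat → F_{0_D}` ("isometry ↦ arbitrary
morphism … [cf. the monoid structure of the monoid `0_D`!]", Prop. 4.4 (iv) and its proof p. 84).
[cite: MochizukiFrdI2008, Prop. 4.4 (iv) p.83] -/
theorem isIsometry_toElemZero {X Y : Birat F hF hsq} (ψ : X ⟶ Y) :
    IsIsometry (toElemZero hF hsq) ψ := rfl

/-! ### Prop. 4.4 (iv): "pre-step ↦ pre-step", read on a fraction -/

/-- If the class `[(α, φ′)]` of a birational fraction is a pre-step of `C^birat` (linear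
base-isomorphism for `C^birat → F_{0_D}`), then `φ′` is a pre-step of `C`: `deg_Fr(φ′) = deg_Fr([(α, φ′)])
= 1`, and `Base(φ′) = Base(α) ≫ Base([(α, φ′)])` is an isomorphism because `Base(α)` is (`α` being a
co-angular pre-step). [cite: MochizukiFrdI2008, Prop. 4.4 (iv) p.83] -/
theorem isPreStep_num {A B : C} (f : BiratFrac F A B)
    (h : IsPreStep (toElemZero hF hsq)
      (homMk f : (toBirat F hF hsq).obj A ⟶ (toBirat F hF hsq).obj B)) :
    IsPreStep F f.num := by
  refine ⟨h.1, ?_⟩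
  haveI : IsIso (Base F f.den) := f.den_mem.2.2
  have hb : IsIso (BiratFrac.base f) := h.2
  have he : Base F f.num = Base F f.den ≫ BiratFrac.base f := by
    unfold BiratFrac.base
    rw [IsIso.hom_inv_id_assoc]
  change IsIso (Base F f.num)
  rw [he]
  infer_instance

/-! ### Prop. 4.8 (i) -/

/-- In the birationalization of a Frobenioid of isotropic type the class of every fraction that is a
pre-step is an isomorphism: `[(α, φ′)] = (α^birat)⁻¹ ≫ φ′^birat` with `α` a co-angular pre-step and
`φ′` a pre-step — hence co-angular, `C` being of isotropic type (Prop. 1.4 (i)) — and `C → C^birat`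
inverts co-angular pre-steps (Prop. 4.4 (iv)). [cite: MochizukiFrdI2008, Prop. 4.8 (i) p.88] -/
theorem isIso_homMk_of_isPreStep (hiso : IsOfIsotropicType F) {A B : C} (f : BiratFrac F A B)
    (h : IsPreStep (toElemZero hF hsq)
      (homMk f : (toBirat F hF hsq).obj A ⟶ (toBirat F hF hsq).obj B)) :
    IsIso (X := (toBirat F hF hsq).obj A) (Y := (toBirat F hF hsq).obj B) (homMk f) := by
  have hnum : IsCoAngularPreStep F f.num :=
    isCoAngularPreStep_of_isotropic hiso (isPreStep_num f h)
  haveI := toBirat_inverts hF hsq f.den f.den_mem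
  haveI := toBirat_inverts hF hsq f.num hnum
  rw [homMk_eq_inv_comp f]
  infer_instance

/-- In the birationalization of a Frobenioid of isotropic type every pre-step is an isomorphism.
[cite: MochizukiFrdI2008, Prop. 4.8 (i) p.88] -/
theorem isIso_of_isPreStep (hiso : IsOfIsotropicType F) {X Y : Birat F hF hsq} (ψ : X ⟶ Y)
    (h : IsPreStep (toElemZero hF hsq) ψ) : IsIso ψ := by
  obtain ⟨f, rfl⟩ := homMk_surjective ψ
  exact isIso_homMk_of_isPreStep hiso (A := X.out) (B := Y.out) f h

/-- Every object of the birationalization of a Frobenioid of isotropic type is isotropic (the "type"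
half of the last sentence of Prop. 4.4 (iv): "An object of `C` maps to an isotropic object of `C^birat`
if … it is an isotropic object of `C`"). [cite: MochizukiFrdI2008, Prop. 4.4 (iv) p.83] -/
theorem isIsotropic (hiso : IsOfIsotropicType F) (X : Birat F hF hsq) :
    IsIsotropic (toElemZero hF hsq) X :=
  fun _ ψ _ hψ => isIso_of_isPreStep hiso ψ hψ

/-- **[FrdI] Proposition 4.8 (i)** for THE birationalization: "If `C` is of isotropic type, then so is
`C^birat`" — for the pre-Frobenioid structure `C^birat → F_{0_D}` of Prop. 4.4 (ii).
[cite: MochizukiFrdI2008, Prop. 4.8 (i) p.88] -/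
theorem isOfIsotropicType (hiso : IsOfIsotropicType F) : IsOfIsotropicType (toElemZero hF hsq) :=
  fun X => isIsotropic hiso X

end Birat

end PreFrobenioid

namespace PreFrobenioidData

variable {D : Type u} [Category.{v} D] {Φ : Dᵒᵖ ⥤ CommMonCat.{w}}
  {C : Type u'} [Category.{v'} C] {F : C ⥤ ElemFrobenioid Φ}

/-- **[FrdI] Proposition 4.8 (i)** through the §3–§4 statement interface: for the operations
`ofFunctor Φ F` of a Frobenioid `F` and the operations `ofFunctor 0_D (C^birat → F_{0_D})` of THE
birationalization, "isotropic type" transfers — literally the body of `Prop48i` at the birationalization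
datum of `C` (whose `ops` are these operations). [cite: MochizukiFrdI2008, Prop. 4.8 (i) p.88] -/
theorem isOfIsotropicType_ofFunctor_toElemZero (hF : PreFrobenioid.IsFrobenioid F)
    (hsq : PreFrobenioid.HasBiratSquares F) (h : (ofFunctor Φ F).IsOfIsotropicType) :
    (ofFunctor (zeroMonoid D) (PreFrobenioid.Birat.toElemZero hF hsq)).IsOfIsotropicType := by
  refine ⟨fun X => (ofFunctor_isIsotropic _ X).mpr ?_⟩
  exact PreFrobenioid.Birat.isOfIsotropicType (fun A => (ofFunctor_isIsotropic F A).mp (h.obj A)) X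

end PreFrobenioidData

end Literature.AlgebraicGeometry.Frobenioids
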